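import Literature.Analysis.FunctionSpaces.BesselJProofs
import Mathlib.Analysis.Calculus.MeanValue
import Mathlib.Analysis.SpecialFunctions.Log.Deriv
import Mathlib.Analysis.SpecialFunctions.Pow.Real
import HarnessLib

/-!
# The variation of the Bessel–exponential weight `g(n) = n^{-1/2} e^{-2πny} J₁(4π√(mn)/c)`

Topic `Literature/NumberTheory/LFunctions` (cell landau-siegel / ls-inputs, input I2 =
`bettin2017_theorem11_primeLevel`, line `hecke_afe_petersson`, stub S4 `stub_offDiagonal`): after
opening the Kloosterman sum in the off-diagonal term of Bettin 2017, Thm. 1.1 (prime level, weight 2,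
`q = 1`, `α = 0`) one bounds `Σ_n e(na/c) g(n)` by partial summation, which needs the total
variation of `g` (`m ≥ 1`, `c > 0`, `y > 0`). Proved here: `abs_besselJ_one_sub_le` (`J₁` is
`3/2`-Lipschitz on `(0,∞)`: DLMF 10.6.2, 10.14.1, 10.14.4), `abs_besselWeight_le`
(`|g(n)| ≤ (2π√m/c)e^{-2πny}`), `abs_besselWeight_succ_sub_le`, `summable_abs_besselWeight_sub`
(`Σ_n |g(n+1) − g(n)| ≤ 2π(3 + 2Λ(y))√m/c`, `Λ(y) = −log(1 − e^{−2πy})`), `tendsto_besselWeight`.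
The weight is written out in every statement (no definition); everything is proved.
-/

noncomputable section

open scoped Real
open Filter Topology Finset
open Literature.Analysis.FunctionSpaces

namespace Literature.NumberTheory.LFunctions.Bettin2017

/-! ### `J₁` is `3/2`-Lipschitz on `(0, ∞)` -/

/-- For `x > 0`: `J₁'(x) = J₀(x) − J₁(x)/x` (DLMF 10.6.2: `(xJ₁)' = xJ₀`). [cite: DLMF, 10.6.2] -/
theorem hasDerivAt_besselJ_one {x : ℝ} (hx : 0 < x) :
    HasDerivAt (besselJ 1) (besselJ 0 x - besselJ 1 x / x) x := by
  have hD := hasDerivAt_besselJ 1 x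
  set D := ∑' k, deriv (fun y ↦ besselJTerm 1 y k) x with hDdef
  have hprod : HasDerivAt (fun y ↦ y * besselJ 1 y) (1 * besselJ 1 x + x * D) x :=
    (hasDerivAt_id' x).mul hD
  have huniq := hprod.unique (hasDerivAt_mul_besselJ_one x)
  have hDeq : D = besselJ 0 x - besselJ 1 x / x := by
    field_simp
    linarith
  rwa [hDeq] at hD

/-- `|J₁'(x)| ≤ 3/2` for `x > 0` (`|J₀| ≤ 1`, `|J₁(x)| ≤ x/2`; DLMF 10.14.1, 10.14.4).
[cite: DLMF, 10.14.1 and 10.14.4] -/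
theorem abs_deriv_besselJ_one_le {x : ℝ} (hx : 0 < x) : |deriv (besselJ 1) x| ≤ 3 / 2 := by
  rw [(hasDerivAt_besselJ_one hx).deriv]
  have h0 := abs_le.mp (abs_besselJ_zero_le_one_holds x)
  have h1 := abs_le.mp (abs_besselJ_one_le_half_mul hx.le)
  have h2 : |besselJ 1 x / x| ≤ 1 / 2 := by
    rw [abs_div, abs_of_pos hx, div_le_iff₀ hx]
    have := abs_besselJ_one_le_half_mul hx.le
    linarith
  have h2' := abs_le.mp h2
  rw [abs_le]
  constructor <;> linarith [h0.1, h0.2, h2'.1, h2'.2]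

/-- **`J₁` is `3/2`-Lipschitz on `(0, ∞)`**: `|J₁(b) − J₁(a)| ≤ (3/2)(b − a)` for `0 < a ≤ b`
(mean value theorem with DLMF 10.6.2, 10.14.1, 10.14.4). [cite: DLMF, 10.6.2 with 10.14.1 and 10.14.4] -/
theorem abs_besselJ_one_sub_le {a b : ℝ} (ha : 0 < a) (hab : a ≤ b) :
    |besselJ 1 b - besselJ 1 a| ≤ 3 / 2 * (b - a) := by
  rcases eq_or_lt_of_le hab with rfl | hlt
  · simp
  have hdiff : DifferentiableOn ℝ (besselJ 1) (Set.Icc a b) :=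
    (differentiable_besselJ 1).differentiableOn
  have hbound : ∀ x ∈ Set.Ico a b, ‖derivWithin (besselJ 1) (Set.Icc a b) x‖ ≤ 3 / 2 := by
    intro x hx
    have hx0 : 0 < x := lt_of_lt_of_le ha hx.1
    rw [((differentiable_besselJ 1) x).derivWithin
      (uniqueDiffOn_Icc hlt x (Set.Ico_subset_Icc_self hx)), Real.norm_eq_abs]
    exact abs_deriv_besselJ_one_le hx0
  have key := norm_image_sub_le_of_norm_deriv_le_segment hdiff hbound b
    (Set.right_mem_Icc.mpr hab)
  rwa [Real.norm_eq_abs] at key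

/-! ### Elementary inequalities -/

/-- `√(n+1) − √n ≤ 1/(2√n)` for `n > 0`. [folklore] -/
private theorem sqrt_add_one_sub_sqrt_le {n : ℝ} (hn : 0 < n) :
    Real.sqrt (n + 1) - Real.sqrt n ≤ 1 / (2 * Real.sqrt n) := by
  have hs : 0 < Real.sqrt n := Real.sqrt_pos.mpr hn
  have hs1 : Real.sqrt n ≤ Real.sqrt (n + 1) := Real.sqrt_le_sqrt (by linarith)
  have hprod : (Real.sqrt (n + 1) - Real.sqrt n) * (Real.sqrt (n + 1) + Real.sqrt n) = 1 := by
    have h1 := Real.mul_self_sqrt (show (0 : ℝ) ≤ n + 1 by linarith)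
    have h2 := Real.mul_self_sqrt hn.le
    nlinarith
  rw [le_div_iff₀ (by positivity)]
  nlinarith

/-- `1/√n − 1/√(n+1) ≤ 1/(2 n √(n+1))` for `n > 0`. [folklore] -/
private theorem inv_sqrt_sub_inv_sqrt_le {n : ℝ} (hn : 0 < n) :
    (Real.sqrt n)⁻¹ - (Real.sqrt (n + 1))⁻¹ ≤ 1 / (2 * n * Real.sqrt (n + 1)) := by
  have hs : 0 < Real.sqrt n := Real.sqrt_pos.mpr hn
  have hs' : 0 < Real.sqrt (n + 1) := Real.sqrt_pos.mpr (by linarith)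
  have h := sqrt_add_one_sub_sqrt_le hn
  have heq : (Real.sqrt n)⁻¹ - (Real.sqrt (n + 1))⁻¹ =
      (Real.sqrt (n + 1) - Real.sqrt n) / (Real.sqrt n * Real.sqrt (n + 1)) := by
    field_simp
  rw [heq, div_le_div_iff₀ (by positivity) (by positivity)]
  have hn2 : Real.sqrt n * Real.sqrt n = n := Real.mul_self_sqrt hn.le
  calc (Real.sqrt (n + 1) - Real.sqrt n) * (2 * n * Real.sqrt (n + 1))
      ≤ (1 / (2 * Real.sqrt n)) * (2 * n * Real.sqrt (n + 1)) :=
        mul_le_mul_of_nonneg_right h (by positivity)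
    _ = 1 * (Real.sqrt n * Real.sqrt (n + 1)) := by
        field_simp
        nlinarith

/-- `0 ≤ 1/√n − 1/√(n+1)`. [folklore] -/
private theorem inv_sqrt_sub_inv_sqrt_nonneg {n : ℝ} (hn : 0 < n) :
    0 ≤ (Real.sqrt n)⁻¹ - (Real.sqrt (n + 1))⁻¹ := by
  have hs : 0 < Real.sqrt n := Real.sqrt_pos.mpr hn
  have hs1 : Real.sqrt n ≤ Real.sqrt (n + 1) := Real.sqrt_le_sqrt (by linarith)
  rw [sub_nonneg]
  exact inv_anti₀ hs hs1

/-- `√(n+1) ≤ 2√n` for `n ≥ 1`. [folklore] -/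
private theorem sqrt_add_one_le_two_mul_sqrt {n : ℝ} (hn : 1 ≤ n) :
    Real.sqrt (n + 1) ≤ 2 * Real.sqrt n := by
  rw [show (2 : ℝ) = Real.sqrt 4 by rw [show (4 : ℝ) = 2 ^ 2 by norm_num, Real.sqrt_sq (by norm_num)],
    ← Real.sqrt_mul (by norm_num)]
  exact Real.sqrt_le_sqrt (by linarith)

/-- `0 ≤ e^{−2πny} − e^{−2π(n+1)y} ≤ 2πy · e^{−2πny}` (`1 − e^{−t} ≤ t`). [folklore] -/
private theorem exp_sub_exp_succ_le {y : ℝ} (hy : 0 ≤ y) (n : ℝ) :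
    0 ≤ Real.exp (-(2 * π * n) * y) - Real.exp (-(2 * π * (n + 1)) * y) ∧
      Real.exp (-(2 * π * n) * y) - Real.exp (-(2 * π * (n + 1)) * y) ≤
        2 * π * y * Real.exp (-(2 * π * n) * y) := by
  have hfac : Real.exp (-(2 * π * (n + 1)) * y) =
      Real.exp (-(2 * π * n) * y) * Real.exp (-(2 * π * y)) := by
    rw [← Real.exp_add]; ring_nf
  have hE : 0 < Real.exp (-(2 * π * n) * y) := Real.exp_pos _
  have h1 : Real.exp (-(2 * π * y)) ≤ 1 := by
    rw [Real.exp_le_one_iff]; nlinarith [Real.pi_pos]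
  have h2 : 1 - Real.exp (-(2 * π * y)) ≤ 2 * π * y := by
    have := Real.add_one_le_exp (-(2 * π * y)); linarith
  rw [hfac]
  constructor
  · nlinarith
  · nlinarith

/-! ### The weight and its variation -/

/-- **Pointwise bound** `|n^{-1/2} e^{-2πny} J₁(4π√(mn)/c)| ≤ (2π√m/c) e^{-2πny}`
(`|J₁(x)| ≤ x/2`, DLMF 10.14.4). [cite: DLMF, 10.14.4] -/
theorem abs_besselWeight_le (m : ℕ) {c : ℝ} (hc : 0 < c) (y : ℝ) (n : ℕ) :
    |(n : ℝ) ^ (-(1 / 2 : ℝ)) * Real.exp (-(2 * π * n) * y) *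
        besselJ 1 (4 * π * Real.sqrt ((m : ℝ) * n) / c)| ≤
      2 * π * Real.sqrt m / c * Real.exp (-(2 * π * n) * y) := by
  rcases Nat.eq_zero_or_pos n with rfl | hn
  · rw [Nat.cast_zero, Real.zero_rpow (by norm_num), zero_mul, zero_mul, abs_zero]
    positivity
  have hn0 : (0 : ℝ) < n := by exact_mod_cast hn
  have hx0 : 0 ≤ 4 * π * Real.sqrt ((m : ℝ) * n) / c := by positivity
  have hJ := abs_besselJ_one_le_half_mul hx0
  have hu : (n : ℝ) ^ (-(1 / 2 : ℝ)) = (Real.sqrt n)⁻¹ := by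
    rw [Real.rpow_neg hn0.le, ← Real.sqrt_eq_rpow]
  have hsn : 0 < Real.sqrt n := Real.sqrt_pos.mpr hn0
  rw [hu, abs_mul, abs_mul, abs_of_pos (inv_pos.mpr hsn), abs_of_pos (Real.exp_pos _),
    Real.sqrt_mul (Nat.cast_nonneg m)]
  rw [Real.sqrt_mul (Nat.cast_nonneg m)] at hJ
  calc (Real.sqrt n)⁻¹ * Real.exp (-(2 * π * n) * y) *
        |besselJ 1 (4 * π * (Real.sqrt m * Real.sqrt n) / c)|
      ≤ (Real.sqrt n)⁻¹ * Real.exp (-(2 * π * n) * y) *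
          (4 * π * (Real.sqrt m * Real.sqrt n) / c / 2) := by gcongr
    _ = 2 * π * Real.sqrt m / c * Real.exp (-(2 * π * n) * y) := by
        field_simp
        ring

/-- **The difference bound** for `n ≥ 1`:
`|g(n+1) − g(n)| ≤ (4π√m/c)·e^{-2πny}/n + (8π²√m/c)·y·e^{-2πny}`, `g(n) = n^{-1/2}e^{-2πny}J₁(4π√(mn)/c)`
(`J₁` is `3/2`-Lipschitz, `|J₁(x)| ≤ x/2`, `√(n+1) − √n ≤ 1/(2√n)`, `1 − e^{−t} ≤ t`).
[cite: DLMF, 10.6.2 with 10.14.1 and 10.14.4] -/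
theorem abs_besselWeight_succ_sub_le {m : ℕ} (hm : 1 ≤ m) {c : ℝ} (hc : 0 < c) {y : ℝ}
    (hy : 0 ≤ y) {n : ℕ} (hn : 1 ≤ n) :
    |((n + 1 : ℕ) : ℝ) ^ (-(1 / 2 : ℝ)) * Real.exp (-(2 * π * ((n + 1 : ℕ) : ℝ)) * y) *
          besselJ 1 (4 * π * Real.sqrt ((m : ℝ) * ((n + 1 : ℕ) : ℝ)) / c) -
        (n : ℝ) ^ (-(1 / 2 : ℝ)) * Real.exp (-(2 * π * n) * y) *
          besselJ 1 (4 * π * Real.sqrt ((m : ℝ) * n) / c)| ≤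
      4 * π * Real.sqrt m / c * (Real.exp (-(2 * π * n) * y) / n) +
        8 * π ^ 2 * Real.sqrt m / c * (y * Real.exp (-(2 * π * n) * y)) := by
  have hn0 : (0 : ℝ) < n := by exact_mod_cast hn
  have hn1 : (1 : ℝ) ≤ n := by exact_mod_cast hn
  push_cast
  -- names
  set s := Real.sqrt (n : ℝ) with hs_def
  set s' := Real.sqrt ((n : ℝ) + 1) with hs'_def
  set v := Real.exp (-(2 * π * n) * y) with hv_def
  set v' := Real.exp (-(2 * π * ((n : ℝ) + 1)) * y) with hv'_def
  set x := 4 * π * (Real.sqrt m * s) / c with hx_def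
  set x' := 4 * π * (Real.sqrt m * s') / c with hx'_def
  have hs : 0 < s := Real.sqrt_pos.mpr hn0
  have hs' : 0 < s' := Real.sqrt_pos.mpr (by linarith)
  have hss' : s ≤ s' := Real.sqrt_le_sqrt (by linarith)
  have hsm : 0 < Real.sqrt (m : ℝ) := Real.sqrt_pos.mpr (by exact_mod_cast hm)
  have hv0 : 0 < v := Real.exp_pos _
  have hv'0 : 0 < v' := Real.exp_pos _
  have hv'v : v' ≤ v := by
    rw [hv_def, hv'_def, Real.exp_le_exp]; nlinarith [Real.pi_pos]
  have hx0 : 0 < x := by positivity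
  have hxx' : x ≤ x' := by rw [hx_def, hx'_def]; gcongr
  -- rewrite the weight
  have hu : ((n : ℝ)) ^ (-(1 / 2 : ℝ)) = s⁻¹ := by
    rw [Real.rpow_neg hn0.le, ← Real.sqrt_eq_rpow]
  have hu' : ((n : ℝ) + 1) ^ (-(1 / 2 : ℝ)) = s'⁻¹ := by
    rw [Real.rpow_neg (by linarith), ← Real.sqrt_eq_rpow]
  rw [hu, hu', Real.sqrt_mul (Nat.cast_nonneg m), Real.sqrt_mul (Nat.cast_nonneg m), ← hs_def,
    ← hs'_def, ← hx_def, ← hx'_def]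
  -- the three pieces
  have hJ' : |besselJ 1 x'| ≤ x' / 2 := abs_besselJ_one_le_half_mul (hx0.le.trans hxx')
  have hLip : |besselJ 1 x' - besselJ 1 x| ≤ 3 / 2 * (x' - x) := abs_besselJ_one_sub_le hx0 hxx'
  have hdx : x' - x ≤ 2 * π * Real.sqrt m / (c * s) := by
    rw [hx'_def, hx_def]
    have h := sqrt_add_one_sub_sqrt_le hn0
    rw [← hs_def, ← hs'_def] at h
    have e1 : 4 * π * (Real.sqrt ↑m * s') / c - 4 * π * (Real.sqrt ↑m * s) / c =
        4 * π * Real.sqrt m / c * (s' - s) := by ring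
    rw [e1]
    calc 4 * π * Real.sqrt ↑m / c * (s' - s) ≤ 4 * π * Real.sqrt ↑m / c * (1 / (2 * s)) := by
          gcongr
      _ = 2 * π * Real.sqrt ↑m / (c * s) := by field_simp; ring
  have hdu : s⁻¹ - s'⁻¹ ≤ 1 / (2 * n * s') := by
    have := inv_sqrt_sub_inv_sqrt_le hn0
    rwa [← hs_def, ← hs'_def] at this
  have hdu0 : 0 ≤ s⁻¹ - s'⁻¹ := by
    have := inv_sqrt_sub_inv_sqrt_nonneg hn0
    rwa [← hs_def, ← hs'_def] at this
  have hdv := exp_sub_exp_succ_le hy (n : ℝ)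
  rw [← hv_def, ← hv'_def] at hdv
  have hs'2 : s' ≤ 2 * s := by
    have := sqrt_add_one_le_two_mul_sqrt hn1
    rwa [← hs_def, ← hs'_def] at this
  -- decomposition
  have hdecomp : s'⁻¹ * v' * besselJ 1 x' - s⁻¹ * v * besselJ 1 x =
      -((s⁻¹ - s'⁻¹) * v' * besselJ 1 x') - s⁻¹ * (v - v') * besselJ 1 x' +
        s⁻¹ * v * (besselJ 1 x' - besselJ 1 x) := by ring
  rw [hdecomp]
  have hT1 : |(s⁻¹ - s'⁻¹) * v' * besselJ 1 x'| ≤ π * Real.sqrt m / c * (v / n) := by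
    rw [abs_mul, abs_mul, abs_of_nonneg hdu0, abs_of_pos hv'0]
    calc (s⁻¹ - s'⁻¹) * v' * |besselJ 1 x'| ≤ (1 / (2 * n * s')) * v * (x' / 2) := by
          gcongr
      _ = π * Real.sqrt m / c * (v / n) := by
          rw [hx'_def]; field_simp; ring
  have hT2 : |s⁻¹ * (v - v') * besselJ 1 x'| ≤ 8 * π ^ 2 * Real.sqrt m / c * (y * v) := by
    rw [abs_mul, abs_mul, abs_of_pos (inv_pos.mpr hs), abs_of_nonneg hdv.1]
    calc s⁻¹ * (v - v') * |besselJ 1 x'| ≤ s⁻¹ * (2 * π * y * v) * (x' / 2) := by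
          gcongr
          exact hdv.2
      _ = 4 * π ^ 2 * Real.sqrt m / c * (y * v) * (s' / s) := by
          rw [hx'_def]; field_simp
      _ ≤ 4 * π ^ 2 * Real.sqrt m / c * (y * v) * 2 := by
          gcongr
          rwa [div_le_iff₀ hs]
      _ = 8 * π ^ 2 * Real.sqrt m / c * (y * v) := by ring
  have hT3 : |s⁻¹ * v * (besselJ 1 x' - besselJ 1 x)| ≤ 3 * π * Real.sqrt m / c * (v / n) := by
    rw [abs_mul, abs_mul, abs_of_pos (inv_pos.mpr hs), abs_of_pos hv0]
    calc s⁻¹ * v * |besselJ 1 x' - besselJ 1 x| ≤ s⁻¹ * v * (3 / 2 * (x' - x)) := by gcongr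
      _ ≤ s⁻¹ * v * (3 / 2 * (2 * π * Real.sqrt m / (c * s))) := by gcongr
      _ = 3 * π * Real.sqrt m / c * (v / (s * s)) := by field_simp
      _ = 3 * π * Real.sqrt m / c * (v / n) := by
          rw [hs_def, Real.mul_self_sqrt hn0.le]
  calc |-((s⁻¹ - s'⁻¹) * v' * besselJ 1 x') - s⁻¹ * (v - v') * besselJ 1 x' +
        s⁻¹ * v * (besselJ 1 x' - besselJ 1 x)|
      ≤ |-((s⁻¹ - s'⁻¹) * v' * besselJ 1 x') - s⁻¹ * (v - v') * besselJ 1 x'| +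
          |s⁻¹ * v * (besselJ 1 x' - besselJ 1 x)| := abs_add_le _ _
    _ ≤ (|-((s⁻¹ - s'⁻¹) * v' * besselJ 1 x')| + |s⁻¹ * (v - v') * besselJ 1 x'|) +
          |s⁻¹ * v * (besselJ 1 x' - besselJ 1 x)| := by
        gcongr
        exact abs_sub _ _
    _ ≤ (π * Real.sqrt m / c * (v / n) + 8 * π ^ 2 * Real.sqrt m / c * (y * v)) +
          3 * π * Real.sqrt m / c * (v / n) := by
        rw [abs_neg]
        gcongr
    _ = 4 * π * Real.sqrt m / c * (v / n) + 8 * π ^ 2 * Real.sqrt m / c * (y * v) := by ring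

/-! ### Summing the variation -/

/-- The logarithmic series `Σ_{n≥1} e^{−2πny}/n = −log(1 − e^{−2πy})` (`y > 0`). [folklore] -/
private theorem hasSum_exp_div_succ {y : ℝ} (hy : 0 < y) :
    HasSum (fun n : ℕ ↦ Real.exp (-(2 * π * ((n : ℝ) + 1)) * y) / ((n : ℝ) + 1))
      (-Real.log (1 - Real.exp (-(2 * π * y)))) := by
  set x := Real.exp (-(2 * π * y)) with hx
  have hx0 : 0 < x := Real.exp_pos _
  have hx1 : x < 1 := by
    rw [hx, ← Real.exp_zero]; exact Real.exp_lt_exp.mpr (by nlinarith [Real.pi_pos])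
  have habs : |x| < 1 := by rw [abs_of_pos hx0]; exact hx1
  have h := Real.hasSum_pow_div_log_of_abs_lt_one habs
  convert h using 1
  funext n
  rw [hx, ← Real.exp_nat_mul]
  congr 1
  push_cast
  ring_nf

/-- The geometric tail `Σ_{n≥1} e^{−2πny} ≤ 1/(2πy)` (`e^t − 1 ≥ t`). [folklore] -/
private theorem tsum_exp_succ_le {y : ℝ} (hy : 0 < y) :
    Summable (fun n : ℕ ↦ Real.exp (-(2 * π * ((n : ℝ) + 1)) * y)) ∧
      ∑' n : ℕ, Real.exp (-(2 * π * ((n : ℝ) + 1)) * y) ≤ 1 / (2 * π * y) := by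
  set x := Real.exp (-(2 * π * y)) with hx
  have hx0 : 0 < x := Real.exp_pos _
  have hx1 : x < 1 := by
    rw [hx, ← Real.exp_zero]; exact Real.exp_lt_exp.mpr (by nlinarith [Real.pi_pos])
  have hterm : ∀ n : ℕ, Real.exp (-(2 * π * ((n : ℝ) + 1)) * y) = x * x ^ n := by
    intro n
    rw [← pow_succ', hx, ← Real.exp_nat_mul]
    congr 1; push_cast; ring
  simp_rw [hterm]
  have hg := hasSum_geometric_of_lt_one hx0.le hx1
  refine ⟨(hg.summable.mul_left x), ?_⟩
  rw [tsum_mul_left, hg.tsum_eq]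
  -- `x/(1-x) ≤ 1/(2πy)` iff `x (1 + 2πy) ≤ 1`, i.e. `1 + t ≤ e^t`
  have h1x : 0 < 1 - x := by linarith
  have hty : 0 < 2 * π * y := by positivity
  have hexp : x * Real.exp (2 * π * y) = 1 := by
    rw [hx, ← Real.exp_add]; simp
  have hle : 2 * π * y + 1 ≤ Real.exp (2 * π * y) := Real.add_one_le_exp _
  have key : x * (2 * π * y) ≤ 1 - x := by nlinarith
  rw [mul_inv_le_iff₀ h1x, one_div_mul_eq_div, le_div_iff₀ hty]
  exact key

/-- **The variation of the weight is summable and `≤ 2π(3 + 2Λ(y))·√m/c`**, where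
`Λ(y) = −log(1 − e^{−2πy}) = Σ_{n≥1} e^{−2πny}/n`, for the weight
`g(n) = n^{-1/2} e^{-2πny} J₁(4π√(mn)/c)` (`c > 0`, `y > 0`): `|g(1) − g(0)| ≤ 2π√m/c` and, for
`n ≥ 1`, `|g(n+1) − g(n)| ≤ (4π√m/c) e^{-2πny}/n + (8π²√m/c) y e^{-2πny}` with
`Σ y e^{-2πny} ≤ 1/(2π)` (DLMF 10.6.2, 10.14.1, 10.14.4 for the Bessel inputs).
[cite: DLMF, 10.6.2 with 10.14.1 and 10.14.4] -/
theorem summable_abs_besselWeight_sub {m : ℕ} (hm : 1 ≤ m) {c : ℝ} (hc : 0 < c) {y : ℝ}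
    (hy : 0 < y) :
    Summable (fun n : ℕ ↦
      |((n + 1 : ℕ) : ℝ) ^ (-(1 / 2 : ℝ)) * Real.exp (-(2 * π * ((n + 1 : ℕ) : ℝ)) * y) *
            besselJ 1 (4 * π * Real.sqrt ((m : ℝ) * ((n + 1 : ℕ) : ℝ)) / c) -
          (n : ℝ) ^ (-(1 / 2 : ℝ)) * Real.exp (-(2 * π * n) * y) *
            besselJ 1 (4 * π * Real.sqrt ((m : ℝ) * n) / c)|) ∧
    ∑' n : ℕ, |((n + 1 : ℕ) : ℝ) ^ (-(1 / 2 : ℝ)) * Real.exp (-(2 * π * ((n + 1 : ℕ) : ℝ)) * y) *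
            besselJ 1 (4 * π * Real.sqrt ((m : ℝ) * ((n + 1 : ℕ) : ℝ)) / c) -
          (n : ℝ) ^ (-(1 / 2 : ℝ)) * Real.exp (-(2 * π * n) * y) *
            besselJ 1 (4 * π * Real.sqrt ((m : ℝ) * n) / c)| ≤
      2 * π * (3 + 2 * (-Real.log (1 - Real.exp (-(2 * π * y))))) * Real.sqrt m / c := by
  set g : ℕ → ℝ := fun n ↦ (n : ℝ) ^ (-(1 / 2 : ℝ)) * Real.exp (-(2 * π * n) * y) *
    besselJ 1 (4 * π * Real.sqrt ((m : ℝ) * n) / c) with hg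
  set Λ := -Real.log (1 - Real.exp (-(2 * π * y))) with hΛ
  -- the dominating sequence on `n ≥ 1`, shifted by one
  set B : ℕ → ℝ := fun n ↦ 4 * π * Real.sqrt m / c *
      (Real.exp (-(2 * π * ((n : ℝ) + 1)) * y) / ((n : ℝ) + 1)) +
    8 * π ^ 2 * Real.sqrt m / c * (y * Real.exp (-(2 * π * ((n : ℝ) + 1)) * y)) with hB
  have hF : ∀ n : ℕ, |g (n + 1 + 1) - g (n + 1)| ≤ B n := by
    intro n
    have h := abs_besselWeight_succ_sub_le hm hc hy.le (n := n + 1) (by omega)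
    simp only [hg, hB]
    push_cast at h ⊢
    exact h
  have hF0 : ∀ n : ℕ, 0 ≤ |g (n + 1 + 1) - g (n + 1)| := fun n ↦ abs_nonneg _
  -- summability and sums of the dominating sequence
  have hL := hasSum_exp_div_succ hy
  obtain ⟨hGs, hGle⟩ := tsum_exp_succ_le hy
  have hBsum : Summable B := by
    refine ((hL.summable.mul_left (4 * π * Real.sqrt m / c)).add
      ((hGs.mul_left y).mul_left (8 * π ^ 2 * Real.sqrt m / c))).congr fun n ↦ ?_
    simp only [hB]
  have hBtsum : ∑' n, B n ≤ 4 * π * Real.sqrt m / c * Λ + 8 * π ^ 2 * Real.sqrt m / c * (y * (1 / (2 * π * y))) := by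
    have h1 : ∑' n, B n = 4 * π * Real.sqrt m / c * Λ +
        8 * π ^ 2 * Real.sqrt m / c * (y * ∑' n : ℕ, Real.exp (-(2 * π * ((n : ℝ) + 1)) * y)) := by
      simp only [hB]
      rw [(hL.summable.mul_left _).tsum_add ((hGs.mul_left y).mul_left _), tsum_mul_left,
        hL.tsum_eq, tsum_mul_left, tsum_mul_left]
    rw [h1]
    gcongr
  -- the shifted variation is summable, hence the variation itself
  have hshift : Summable (fun n : ℕ ↦ |g (n + 1 + 1) - g (n + 1)|) :=
    Summable.of_nonneg_of_le hF0 hF hBsum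
  have hsum : Summable (fun n : ℕ ↦ |g (n + 1) - g n|) :=
    (summable_nat_add_iff 1 (f := fun n : ℕ ↦ |g (n + 1) - g n|)).mp hshift
  refine ⟨by simpa [hg] using hsum, ?_⟩
  -- `Σ = |g 1 - g 0| + Σ_{n ≥ 1}`
  have hsplit := hsum.tsum_eq_zero_add
  have h0 : |g (0 + 1) - g 0| ≤ 2 * π * Real.sqrt m / c := by
    have h1 := abs_besselWeight_le m hc y 1
    have hg0 : g 0 = 0 := by
      simp only [hg, Nat.cast_zero, Real.zero_rpow (show (-(1 / 2 : ℝ)) ≠ 0 by norm_num),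
        zero_mul]
    rw [zero_add, hg0, sub_zero]
    refine h1.trans ?_
    have he : Real.exp (-(2 * π * ((1 : ℕ) : ℝ)) * y) ≤ 1 := by
      rw [Real.exp_le_one_iff]; push_cast; nlinarith [Real.pi_pos]
    calc 2 * π * Real.sqrt ↑m / c * Real.exp (-(2 * π * ((1 : ℕ) : ℝ)) * y)
        ≤ 2 * π * Real.sqrt ↑m / c * 1 := by gcongr
      _ = 2 * π * Real.sqrt ↑m / c := mul_one _
  have htail : ∑' n, |g (n + 1 + 1) - g (n + 1)| ≤ ∑' n, B n :=
    hshift.tsum_le_tsum hF hBsum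
  have hyy : y * (1 / (2 * π * y)) = 1 / (2 * π) := by field_simp
  have hfinal : ∑' n, |g (n + 1) - g n| ≤ 2 * π * (3 + 2 * Λ) * Real.sqrt m / c := by
    rw [hsplit]
    calc |g (0 + 1) - g 0| + ∑' n, |g (n + 1 + 1) - g (n + 1)|
        ≤ 2 * π * Real.sqrt m / c + (4 * π * Real.sqrt m / c * Λ +
            8 * π ^ 2 * Real.sqrt m / c * (y * (1 / (2 * π * y)))) :=
          add_le_add h0 (htail.trans hBtsum)
      _ = 2 * π * (3 + 2 * Λ) * Real.sqrt m / c := by rw [hyy]; field_simp; ring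
  simpa [hg] using hfinal

/-- **The weight tends to `0`** (it is `≤ (2π√m/c) e^{−2πny}` in absolute value, DLMF 10.14.4).
[cite: DLMF, 10.14.4] -/
theorem tendsto_besselWeight (m : ℕ) {c : ℝ} (hc : 0 < c) {y : ℝ} (hy : 0 < y) :
    Tendsto (fun n : ℕ ↦ (n : ℝ) ^ (-(1 / 2 : ℝ)) * Real.exp (-(2 * π * n) * y) *
        besselJ 1 (4 * π * Real.sqrt ((m : ℝ) * n) / c)) atTop (𝓝 0) := by
  have hgeom : Tendsto (fun n : ℕ ↦ 2 * π * Real.sqrt m / c * Real.exp (-(2 * π * n) * y))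
      atTop (𝓝 (2 * π * Real.sqrt m / c * 0)) := by
    refine (Tendsto.const_mul _ ?_)
    have hx1 : Real.exp (-(2 * π * y)) < 1 := by
      rw [← Real.exp_zero]; exact Real.exp_lt_exp.mpr (by nlinarith [Real.pi_pos])
    have h := tendsto_pow_atTop_nhds_zero_of_lt_one (Real.exp_pos _).le hx1
    refine h.congr fun n ↦ ?_
    rw [← Real.exp_nat_mul]; congr 1; ring
  rw [mul_zero] at hgeom
  exact squeeze_zero_norm (fun n ↦ by
    rw [Real.norm_eq_abs]; exact abs_besselWeight_le m hc y n) hgeom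

end Literature.NumberTheory.LFunctions.Bettin2017

end
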